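import Summits.BirchSwinnertonDyer.BirchSwinnertonDyer.Theses.PrintX10b
import Literature.NumberTheory.EllipticCurves.MatarNekovar2019.IrreducibleOverQuadraticFieldProofs
import HarnessLib

/-!
# Route PrintX10b — aside `MatarNekovarIrreducibleBaseChange` (stmt-BirchSwinnertonDyer-21208), PROVED by name

Cell `bsd-print-x9` (D-0131 (2) PRINT tier), seat `bsd-print-x9-p1` (prover p1, gen 3). The rev-3 aside
item-states the named fact Matar–Nekovář 2019 Prop. 5.26 (2)
(`MatarNekovar2019.prop526_hasIrreducibleModPGaloisRep_baseChange`: for `E/ℚ`, `K` quadratic with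
`(N_E, d_K) = 1`, `p ≠ 2`, `E[p]` irreducible over `ℚ` ⟹ irreducible over `K`; conjunct 6 = binder `h526` of
the Heegner print bundle `HeegnerPrintFactsX10b`), which seat ty1 PROVED in the tree for every odd `p` — so in
particular at the route's prime `p = 3` (`…prop526_hasIrreducibleModPGaloisRep_baseChange_holds`, file
`Literature/NumberTheory/EllipticCurves/MatarNekovar2019/IrreducibleOverQuadraticFieldProofs.lean`, p548563 +
p549855; the `p = 3` ordinary case is its §6). This file reads that theorem on the route declaration so the
aside closes BY NAME (X9 twin: `Theorems/PrintX9MatarNekovarIrreducibleBaseChange.lean`, item 20533).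
HONEST STATUS: closes one print aside of route PrintX10b; no crux moves; BSD is not proved.
beyond-print theorem: no.
-/

namespace Summit.BirchSwinnertonDyer.Rank1Residual.X10

/-- **Aside 21208 of route PrintX10b** — Matar–Nekovář 2019 Prop. 5.26 (2) (irreducibility of `E[p]` over a
quadratic field `K` with `(N_E, d_K) = 1`, `p ≠ 2`, from irreducibility over `ℚ`), as the route declaration
`Theses.PrintX10b.MatarNekovarIrreducibleBaseChange`; proof = the typer's theorem
`MatarNekovar2019.prop526_hasIrreducibleModPGaloisRep_baseChange_holds` (all odd `p`, hence `p = 3`).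
[cite: MatarNekovar2019, Prop. 5.26 (2) (p. 492) and its proof (p. 493)]
[cite: Serre1972, Prop. 11 and Prop. 12] -/
theorem printX10b_matarNekovarIrreducibleBaseChange_proof :
    Summit.BirchSwinnertonDyer.BirchSwinnertonDyer.Theses.PrintX10b.MatarNekovarIrreducibleBaseChange :=
  Literature.NumberTheory.EllipticCurves.MatarNekovar2019.prop526_hasIrreducibleModPGaloisRep_baseChange_holds

end Summit.BirchSwinnertonDyer.Rank1Residual.X10
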